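import Mathlib

/-!
# Solo-blind seat (MatrixMultiplication), s71 — the Value-Relation Theorem (paper/KraftK3.md §7.12, K3.12.15 (R3′))

NETWORK STRUCTURE / VALUE RELATION.  Let `Q` be a quadratic map of `𝔽₃`-modules, `F = Q + ℓ + κ`, and let a frame `v : ι → M` be
given; points are `x_y = Σ_i y_i • v_i` for coordinate vectors `y : ι → 𝔽₃`.  If a weight function `ν` on a finite set `S` of coordinate
vectors is ORTHOGONAL TO THE MULTILINEAR MONOMIALS OF DEGREE ≤ 2 (`Σ ν = 0`, `Σ ν·y_i = 0`, `Σ ν·y_i y_k = 0` for `i ≠ k`) and all the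
points `x_y`, `y ∈ S`, lie in ONE LEVEL SET `{F = c}`, then the values `Q(v_i)` satisfy the linear relation
`Σ_i σ_i • Q(v_i) = 0` with `σ_i = Σ_y ν(y) y_i²` (`valueRelation`).  Reason: pairing `ν` with `F` kills everything except the squares,
since in frame coordinates `F = Σ_i y_i² Q(v_i) + Σ_{i<k} y_i y_k B(v_i, v_k) + Σ_i y_i ℓ(v_i) + κ`.  In the frame-certificate programme
(`SoloBlindFrameCertificate`, `SoloBlindLineIdentity`, `SoloBlindChainLemma`, `SoloBlindCombLemma`) a dependency among the multilinear
evaluation vectors of a level set is such a `ν` (orthogonal to ALL multilinear monomials), so every obstruction to goodness forces a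
value relation with relation vector `σ(ν)`: frames with linearly independent values fail only through BALANCED networks (`σ = 0`).
Pure algebra; no `ω` content.
-/

set_option linter.dupNamespace false
set_option autoImplicit false

namespace Summit.MatrixMultiplication.MatrixMultiplication.Theorems

open Finset

variable {M N : Type*} [AddCommGroup M] [Module (ZMod 3) M] [AddCommGroup N] [Module (ZMod 3) N]
variable {ι : Type*} [Fintype ι] [DecidableEq ι]

omit [Fintype ι] [DecidableEq ι] in
/-- Off-diagonal polar terms scale by the multilinear monomial `y_i y_k`. -/
theorem polarSym2_map_smul_frame (Q : QuadraticMap (ZMod 3) M N) (v : ι → M) (y : ι → ZMod 3) (p : Sym2 ι) :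
    QuadraticMap.polarSym2 Q (p.map fun i => y i • v i) = (p.map y).mul • QuadraticMap.polarSym2 Q (p.map v) := by
  induction p using Sym2.ind with
  | h i k =>
    simp only [Sym2.map_mk, QuadraticMap.polarSym2_sym2Mk, QuadraticMap.polar_smul_left, QuadraticMap.polar_smul_right,
      Sym2.mul_mk, smul_smul, mul_comm]

/-- VALUE-RELATION THEOREM (K3.12.15 (R3′)): a weight function on coordinate vectors that is orthogonal to `1`, to the `y_i` and to the
`y_i y_k` (`i ≠ k`), and whose points all lie in one level set of `Q + ℓ + κ`, forces the relation `Σ_i (Σ_y ν y · y_i²) • Q(v_i) = 0`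
among the frame values. -/
theorem valueRelation (Q : QuadraticMap (ZMod 3) M N) (ℓ : M →ₗ[ZMod 3] N) (κ c : N) (v : ι → M)
    (S : Finset (ι → ZMod 3)) (ν : (ι → ZMod 3) → ZMod 3)
    (h0 : ∑ y ∈ S, ν y = 0) (h1 : ∀ i, ∑ y ∈ S, ν y * y i = 0)
    (h2 : ∀ p : Sym2 ι, ¬ p.IsDiag → ∑ y ∈ S, ν y * (p.map y).mul = 0)
    (hS : ∀ y ∈ S, Q (∑ i, y i • v i) + ℓ (∑ i, y i • v i) + κ = c) :
    ∑ i, (∑ y ∈ S, ν y * (y i * y i)) • Q (v i) = 0 := by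
  -- pair ν with F: the total is (Σ ν) • c = 0
  have total : ∑ y ∈ S, ν y • (Q (∑ i, y i • v i) + ℓ (∑ i, y i • v i) + κ) = 0 := by
    rw [Finset.sum_congr rfl (fun y hy => by rw [hS y hy]), ← Finset.sum_smul, h0, zero_smul]
  -- expand each summand in frame coordinates
  have expand : ∀ y ∈ S, ν y • (Q (∑ i, y i • v i) + ℓ (∑ i, y i • v i) + κ) =
      ∑ i, (ν y * (y i * y i)) • Q (v i)
        + ∑ p ∈ (Finset.univ : Finset ι).sym2 with ¬ p.IsDiag, (ν y * (p.map y).mul) • QuadraticMap.polarSym2 Q (p.map v)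
        + ∑ i, (ν y * y i) • ℓ (v i) + ν y • κ := by
    intro y _
    rw [QuadraticMap.map_sum Q Finset.univ (fun i => y i • v i), map_sum]
    simp only [QuadraticMap.map_smul, map_smul, polarSym2_map_smul_frame, smul_add, Finset.smul_sum, smul_smul]
  rw [Finset.sum_congr rfl expand, Finset.sum_add_distrib, Finset.sum_add_distrib, Finset.sum_add_distrib] at total
  -- the three non-square groups vanish
  have T2 : ∑ y ∈ S, ∑ p ∈ (Finset.univ : Finset ι).sym2 with ¬ p.IsDiag,
      (ν y * (p.map y).mul) • QuadraticMap.polarSym2 Q (p.map v) = 0 := by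
    rw [Finset.sum_comm]
    refine Finset.sum_eq_zero fun p hp => ?_
    rw [← Finset.sum_smul, h2 p (Finset.mem_filter.mp hp).2, zero_smul]
  have T3 : ∑ y ∈ S, ∑ i, (ν y * y i) • ℓ (v i) = 0 := by
    rw [Finset.sum_comm]
    refine Finset.sum_eq_zero fun i _ => ?_
    rw [← Finset.sum_smul, h1 i, zero_smul]
  have T4 : ∑ y ∈ S, ν y • κ = 0 := by rw [← Finset.sum_smul, h0, zero_smul]
  have T1 : ∑ y ∈ S, ∑ i, (ν y * (y i * y i)) • Q (v i) = ∑ i, (∑ y ∈ S, ν y * (y i * y i)) • Q (v i) := by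
    rw [Finset.sum_comm]; simp only [Finset.sum_smul]
  rw [T2, T3, T4, T1, add_zero, add_zero, add_zero] at total
  exact total

end Summit.MatrixMultiplication.MatrixMultiplication.Theorems
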